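import Summits.QuantumFields.GaugeBoot.Rows.KZL2HD3YCol
import Summits.QuantumFields.GaugeBoot.Rows.KZL2HD3HTab
import Summits.QuantumFields.GaugeBoot.Rows.RedEnc
import HarnessLib

/-!
# Gauge-boot: kernel check of the REDUCTION IDENTITY of the kz-L2-H-3D problems, blocks 3 (part 3/18)

Cell `pub-gaugeboot` (HOME `run/shared/lean/pub/pub-gaugeboot/`), seat lean1 (torus layer for rows C1–C2 (and C41–C50) = the certified
kz-L2-H-3D windows: label set, raw blocks, class/witness tables, the reduction identity, per-β bindings).

HONEST FRAMING (page 1 of every file of this cell): certified bounds on lattice expectations at STATED coupling,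
gauge group, dimension and torus size; NOT a mass gap, NOT a continuum limit, NOT a string tension, NOT large `N`.
The venture is explicitly NOT Yang–Mills-summit-bearing (barriers `FixedCouplingUltralocality`,
`PerturbativeInvisibility`).

For each listed block `k` and `i ≤ j < bdim k` in the stated rectangles: the expansion of `(Y_k)ᵢᵀ · cls · (Y_k)ⱼ` over the raw
class table of the block's family (`hcls` / `scls` / `lcls`) EQUALS, as an integer linear form in the 1203 variables, lean3's
transcription `Certificates.KZL2HD3.ent k i j` of the problem files' entry — checked through the radix-`2^20` encoding `RedEnc.encCheck`
(one big-integer identity per entry, `decide +kernel` on index rectangles of ≤ 40000 expansion terms); assemblies `red_ok_k`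
(`i ≤ j`) + range facts `ycol_lt_k` sit with a block's last rectangle, or in `KZL2HD3RedAsm` when a block spans parts.  Consumed by `KZL2HD3Red`.
-/

set_option Elab.async false

noncomputable section

open Literature.MathematicalPhysics.QuantumFieldTheory

namespace Summit.QuantumFields.GaugeBoot

namespace KZL2HD3

set_option maxHeartbeats 0 in
/-- Reduction identity (kz-L2-H-3D), block 3, rows `0 ≤ i < 1`, columns `max i 0 ≤ j < 3` (27648 expansion terms; kernel). -/
theorem red_ok_3_0 : ∀ i j : Fin 3, 0 ≤ i.val → i.val < 1 → 0 ≤ j.val → j.val < 3 → i.val ≤ j.val →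
    RedEnc.encCheck 20 1203 (KZL2HD3.ycol 3 i) (KZL2HD3.ycol 3 j) (fun a b => (KZL2HD3.hcls a b).val) (Certificates.KZL2HD3.ent 3 i j) = true := by
  decide +kernel

set_option maxHeartbeats 0 in
/-- Reduction identity (kz-L2-H-3D), block 3, rows `1 ≤ i < 3`, columns `max i 0 ≤ j < 3` (27648 expansion terms; kernel). -/
theorem red_ok_3_1 : ∀ i j : Fin 3, 1 ≤ i.val → i.val < 3 → 0 ≤ j.val → j.val < 3 → i.val ≤ j.val →
    RedEnc.encCheck 20 1203 (KZL2HD3.ycol 3 i) (KZL2HD3.ycol 3 j) (fun a b => (KZL2HD3.hcls a b).val) (Certificates.KZL2HD3.ent 3 i j) = true := by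
  decide +kernel

/-- The raw-line indices of the columns of `Y_3` (kz-L2-H-3D) are `< 553`. -/
theorem ycol_lt_3 : ∀ i < 3, ∀ p ∈ KZL2HD3.ycol 3 i, p.1 < 553 := by decide +kernel

/-- **Reduction identity, block 3** of the kz-L2-H-3D problems (`H/irrep3(d1,c+)`, 3 × 3; 55296 expansion terms on
`i ≤ j`): lean3's entries are `Y_3ᵀ·cls·Y_3` entry by entry (radix check). -/
theorem red_ok_3 (i j : Fin 3) (hij : i.val ≤ j.val) :
    RedEnc.encCheck 20 1203 (KZL2HD3.ycol 3 i) (KZL2HD3.ycol 3 j) (fun a b => (KZL2HD3.hcls a b).val) (Certificates.KZL2HD3.ent 3 i j) = true := by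
  have hi0 : 0 ≤ i.val := Nat.zero_le _
  have hj0 : 0 ≤ j.val := Nat.zero_le _
  have him : i.val < 3 := i.isLt
  have hjm : j.val < 3 := j.isLt
  rcases Nat.lt_or_ge i.val 1 with hi1 | hi1
  · exact red_ok_3_0 i j hi0 hi1 hj0 hjm hij
  exact red_ok_3_1 i j hi1 him hj0 hjm hij

end KZL2HD3

end Summit.QuantumFields.GaugeBoot

end
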